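import Summits.ResolutionOfSingularities.ResolutionOfSingularities.Theorems.NonRuledCofinite.Negative.FalseWithoutSingularCentre
import Summits.ResolutionOfSingularities.ResolutionOfSingularities.Theorems.NonRuledCofinite.Negative.StubExceptionalPrimesWithoutHeightOne
import Literature.AlgebraicGeometry.Resolution.DivisorialPlace

/-!
# `NonRuledCofinite` (crux `stmt-ResolutionOfSingularities-18076`): the exceptional set is
# non-empty at the cusp, and the dimension threshold `2` is where content starts

Negative / tightness lemmas for the crux `NonRuledCofinite` of route
`ResolutionOfSingularities/RuledResidues` (cdisprove seat, `--supports
stmt-ResolutionOfSingularities-18076`; work file `Cruxes/NonRuledCofinite/Disproof.lean`; kit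
`FalseWithoutSingularCentre.lean`, non-normality test `StubExceptionalPrimesWithoutHeightOne.lean`).
The crux: for an affine model `R ⊆ K` with `HasResolution (Spec R)`, the valuation rings `W` with
(1) `k ⊆ W`, (2) DVR, (3) essentially of finite type, (4) `R ⊆ W` with `R_{𝔪_W ∩ R}` not regular,
(5) no regular local ring of dimension `≥ 2` of an affine model dominated, are finitely many.

* `nonRuledCofinite_threshold_one_vacuous` — TIGHTNESS of the `2` in (5): with `1 ≤ dim` instead
  the set is EMPTY for every `R` (no resolution needed): `A = R ⊔ B` (`B` from (3)) is an affine
  model inside `W` with `A_{𝔪_W ∩ A} ≅ W`, a DVR — regular of dimension one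
  (`exists_goodModel_of_dim_one`).  So `2` is the first threshold with content.
* `cuspModel k = k[t², t³] ⊆ k(t)`: finitely generated, `Frac = k(t)`, and its local ring at the
  cusp is NOT regular (`not_isRegularLocalRing_cusp`: every element of `k + t²k[t]` has vanishing
  `t¹`-coefficient, so `t ≠ a/s` with `s(0) ≠ 0`, while `t² ∈ R`).
* `cuspPlace_mem_exceptionalSet` — `W = k[t]_{(t)}` satisfies ALL FIVE conjuncts for
  `R = k[t², t³]`: the typed predicate of the crux is jointly satisfiable, hence
* `not_nonRuledCofinite_empty` — the strengthening of the crux with `Set.Finite` replaced by `= ∅`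
  (everything else verbatim) is FALSE (`Spec k[t², t³]` has a resolution:
  `hasResolution_of_dim_le_one`, unconditional in the tree).
* `stub_exceptionalCentre_false_without_isRegularRing` — line `regular-atlas`
  (`Cruxes/NonRuledCofinite/Lines/regular_atlas.lean`), stub 2 with `IsRegularRing B` deleted is
  FALSE at `R = B = k[t², t³]`, `W = k[t]_{(t)}` (`t ∈ W ∖ B_𝔭`).

References: Matsumura, *Commutative Ring Theory*, Thm. 11.2, Thm. 19.4; Hartshorne, *Algebraic
Geometry*, I Ex. 3.2 (the cuspidal cubic), II Ex. 6.11; Zariski–Samuel II, Ch. VI §14.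
-/

noncomputable section

set_option linter.dupNamespace false

open Polynomial IsDedekindDomain AlgebraicGeometry
open Literature.AlgebraicGeometry.Resolution

namespace Summit.ResolutionOfSingularities.ResolutionOfSingularities.Theorems.NonRuledCofinite.Negative

/-! ## Tightness of the threshold `2` in conjunct (5)

With `1 ≤ dim` in place of `2 ≤ dim` NO valuation ring passes conjuncts (2), (3) together with
`R ⊆ W`: the algebra `A = R ⊔ B` generated by `R` and the `B` of (3) is an affine model of `K`
inside `W` whose local ring at the centre is `W` itself — a DVR, regular of dimension one.  So the
threshold-`1` (or threshold-free) version of the crux holds VACUOUSLY for every `R`, resolution or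
not: `2` is the first value with content (and `3` is false for surfaces, see the docblock). -/

/-- A bigger subalgebra of an affine model is an affine model. [folklore] -/
theorem isFractionRing_of_le' {k K : Type} [Field k] [Field K] [Algebra k K]
    {A A' : Subalgebra k K} (hle : A ≤ A') (hA : IsFractionRing A K) : IsFractionRing A' K := by
  refine IsFractionRing.of_field A' K fun z => ?_
  obtain ⟨a, b, -, rfl⟩ := IsFractionRing.div_surjective (A := A) z
  exact ⟨⟨a, hle a.2⟩, ⟨b, hle b.2⟩, rfl⟩

/-- **Every DVR `W ⊇ R` essentially of finite type dominates a regular local ring of dimension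
`≥ 1` of an affine model — namely itself** (`A = R ⊔ B`, `A_{𝔪_W ∩ A} ≅ W`). [folklore] -/
theorem exists_goodModel_of_dim_one {k K : Type} [Field k] [Field K] [Algebra k K]
    (R : Subalgebra k K) (hR : R.FG) (hfr : IsFractionRing R K) (W : ValuationSubring K)
    (hdvr : IsDiscreteValuationRing W)
    (hft : ∃ B : Subalgebra k K, B.FG ∧ B.toSubring ≤ W.toSubring ∧ ∀ x : K, x ∈ W →
      ∃ b s : K, b ∈ B ∧ s ∈ B ∧ s ∉ W.nonunits ∧ x * s = b)
    (hRW : R.toSubring ≤ W.toSubring) :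
    ∃ A : Subalgebra k K, A.FG ∧ IsFractionRing A K ∧ ∃ h : A.toSubring ≤ W.toSubring,
      IsRegularLocalRing (Localization.AtPrime
        (Ideal.comap (Subring.inclusion h) (IsLocalRing.maximalIdeal W))) ∧
      (1 : WithBot ℕ∞) ≤ ringKrullDim (Localization.AtPrime
        (Ideal.comap (Subring.inclusion h) (IsLocalRing.maximalIdeal W))) := by
  obtain ⟨B, hB, hBW, hsurj⟩ := hft
  -- `W` as a `k`-subalgebra, and `A = R ⊔ B ⊆ W`
  let W' : Subalgebra k K :=
    { W.toSubring with
      algebraMap_mem' := fun c => hRW (R.algebraMap_mem c) }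
  have hRW' : R ≤ W' := fun x hx => hRW hx
  have hBW' : B ≤ W' := fun x hx => hBW hx
  let A : Subalgebra k K := R ⊔ B
  have hAW : A.toSubring ≤ W.toSubring := fun x hx => (sup_le hRW' hBW' : A ≤ W') hx
  refine ⟨A, hR.sup hB, isFractionRing_of_le' le_sup_left hfr, hAW, ?_⟩
  set 𝔮 := Ideal.comap (Subring.inclusion hAW) (IsLocalRing.maximalIdeal W)
  -- the localization `A_𝔮 → W` is bijective
  have hunits : ∀ y : 𝔮.primeCompl, IsUnit (Subring.inclusion hAW y) := by
    intro y
    by_contra hy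
    exact y.2 ((IsLocalRing.mem_maximalIdeal _).mpr hy)
  let f : Localization.AtPrime 𝔮 →+* W := IsLocalization.lift (M := 𝔮.primeCompl) hunits
  have hf_inj : Function.Injective f := by
    refine (IsLocalization.lift_injective_iff _).mpr fun x y => ?_
    constructor
    · intro hxy
      exact congrArg _ ((IsLocalization.injective (Localization.AtPrime 𝔮)
        𝔮.primeCompl_le_nonZeroDivisors) hxy)
    · intro hxy
      have h1 : ((Subring.inclusion hAW x : W) : K) = (Subring.inclusion hAW y : W) :=
        congrArg (fun z : W => (z : K)) hxy
      have hxy' : (x : K) = y := h1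
      rw [Subtype.ext hxy']
  have hf_surj : Function.Surjective f := by
    intro w
    obtain ⟨b, s, hb, hs, hsu, hws⟩ := hsurj w w.2
    have hs𝔮 : (⟨s, le_sup_right (b := B) hs⟩ : A) ∈ 𝔮.primeCompl := by
      intro hmem
      apply hsu
      have := (ValuationSubring.coe_mem_nonunits_iff (A := W)).mpr (Ideal.mem_comap.mp hmem)
      exact this
    refine ⟨IsLocalization.mk' _ (⟨b, le_sup_right (b := B) hb⟩ : A) ⟨_, hs𝔮⟩, ?_⟩
    rw [IsLocalization.lift_mk'_spec]
    apply Subtype.ext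
    change b = s * (w : K)
    rw [mul_comm, hws]
  let e : Localization.AtPrime 𝔮 ≃+* W := RingEquiv.ofBijective f ⟨hf_inj, hf_surj⟩
  haveI := hdvr
  refine ⟨IsRegularLocalRing.of_ringEquiv e.symm, ?_⟩
  rw [ringKrullDim_eq_of_ringEquiv e,
    IsPrincipalIdealRing.ringKrullDim_eq_one W (IsDiscreteValuationRing.not_isField W)]

/-- **THRESHOLD `≤ 1` IS VACUOUS**: the crux with `2 ≤ dim` replaced by `1 ≤ dim` in conjunct (5)
holds for every affine model `R`, with NO resolution hypothesis — its set is empty. [folklore] -/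
theorem nonRuledCofinite_threshold_one_vacuous :
    ∀ (k K : Type) [Field k] [Field K] [Algebra k K] (R : Subalgebra k K), R.FG →
      IsFractionRing R K →
      {W : ValuationSubring K | (∀ c : k, algebraMap k K c ∈ W) ∧ IsDiscreteValuationRing W ∧
        (∃ B : Subalgebra k K, B.FG ∧ B.toSubring ≤ W.toSubring ∧ ∀ x : K, x ∈ W →
          ∃ b s : K, b ∈ B ∧ s ∈ B ∧ s ∉ W.nonunits ∧ x * s = b) ∧
        (∃ h : R.toSubring ≤ W.toSubring, ¬ IsRegularLocalRing (Localization.AtPrime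
          (Ideal.comap (Subring.inclusion h) (IsLocalRing.maximalIdeal W)))) ∧
        ¬ (∃ A : Subalgebra k K, A.FG ∧ IsFractionRing A K ∧ ∃ h : A.toSubring ≤ W.toSubring,
          IsRegularLocalRing (Localization.AtPrime
            (Ideal.comap (Subring.inclusion h) (IsLocalRing.maximalIdeal W))) ∧
          (1 : WithBot ℕ∞) ≤ ringKrullDim (Localization.AtPrime
            (Ideal.comap (Subring.inclusion h) (IsLocalRing.maximalIdeal W))))} = ∅ := by
  intro k K _ _ _ R hR hfr
  refine Set.eq_empty_iff_forall_notMem.mpr ?_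
  rintro W ⟨-, hdvr, hft, ⟨hRW, -⟩, hno⟩
  exact hno (exists_goodModel_of_dim_one R hR hfr W hdvr hft hRW)

/-! ## The cuspidal model `k[t², t³] ⊆ k(t)`

The cheapest SINGULAR affine model with a resolution in the tree (`hasResolution_of_dim_le_one` is
unconditional).  Its local ring at the cusp is not regular because it is not integrally closed
(`t² ∈ R`, `t ∉ R_𝔮`: every element of `R = k + t²k[t]` has vanishing `t¹`-coefficient). -/

variable (k : Type) [Field k]

/-- The cuspidal affine model `k[t², t³] ⊆ k(t)` (`t = RatFunc.X`). [folklore] -/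
def cuspModel : Subalgebra k (RatFunc k) :=
  Algebra.adjoin k {(RatFunc.X : RatFunc k) ^ 2, (RatFunc.X : RatFunc k) ^ 3}

/-- `k[t², t³]` is finitely generated. [folklore] -/
theorem cuspModel_fg : (cuspModel k).FG :=
  Subalgebra.fg_def.mpr ⟨_, (Set.finite_singleton _).insert _, rfl⟩

/-- `tᵐ ∈ k[t², t³]` for `m ≥ 2`. [folklore] -/
theorem pow_mem_cuspModel {m : ℕ} (hm : 2 ≤ m) : (RatFunc.X : RatFunc k) ^ m ∈ cuspModel k := by
  induction m using Nat.strong_induction_on with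
  | _ m ih =>
    rcases Nat.lt_or_ge m 4 with h4 | h4
    · interval_cases m
      · exact Algebra.subset_adjoin (by simp)
      · exact Algebra.subset_adjoin (by simp)
    · have : (RatFunc.X : RatFunc k) ^ m = RatFunc.X ^ 2 * RatFunc.X ^ (m - 2) := by
        rw [← pow_add]; congr 1; omega
      rw [this]
      exact Subalgebra.mul_mem _ (Algebra.subset_adjoin (by simp))
        (ih (m - 2) (by omega) (by omega))

/-- `t² · k[t] ⊆ k[t², t³]`. [folklore] -/
theorem Xsq_mul_algebraMap_mem_cuspModel (p : k[X]) :
    (RatFunc.X : RatFunc k) ^ 2 * algebraMap k[X] (RatFunc k) p ∈ cuspModel k := by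
  induction p using Polynomial.induction_on' with
  | add p q hp hq =>
    rw [map_add, mul_add]
    exact Subalgebra.add_mem _ hp hq
  | monomial n c =>
    rw [← C_mul_X_pow_eq_monomial, map_mul, map_pow, RatFunc.algebraMap_X,
      Polynomial.C_eq_algebraMap, ← IsScalarTower.algebraMap_apply, ← mul_assoc,
      mul_comm (RatFunc.X ^ 2), mul_assoc, ← pow_add]
    exact Subalgebra.mul_mem _ (Subalgebra.algebraMap_mem _ c) (pow_mem_cuspModel k (by omega))

/-- `k[t², t³] ⊆ k[t]`. [folklore] -/
theorem cuspModel_le_polyModel : cuspModel k ≤ polyModel k := by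
  refine Algebra.adjoin_le ?_
  rintro _ (rfl | rfl)
  · have h := algebraMap_mem_polyModel k (X ^ 2)
    rwa [map_pow, RatFunc.algebraMap_X] at h
  · have h := algebraMap_mem_polyModel k (X ^ 3)
    rwa [map_pow, RatFunc.algebraMap_X] at h

/-- `Frac k[t², t³] = k(t)` (`z = t²·num / t²·denom`). [folklore] -/
instance isFractionRing_cuspModel : IsFractionRing (cuspModel k) (RatFunc k) := by
  refine IsFractionRing.of_field (cuspModel k) (RatFunc k) fun z => ?_
  refine ⟨⟨_, Xsq_mul_algebraMap_mem_cuspModel k z.num⟩,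
    ⟨_, Xsq_mul_algebraMap_mem_cuspModel k z.denom⟩, ?_⟩
  change z = (RatFunc.X ^ 2 * _) / (RatFunc.X ^ 2 * _)
  rw [mul_div_mul_left _ _ (pow_ne_zero 2 RatFunc.X_ne_zero), RatFunc.num_div_denom]

/-- The invariant separating `k[t², t³]` from `k[t]`: vanishing `t¹`-coefficient. [folklore] -/
theorem exists_coeff_one_eq_zero_of_mem_cuspModel {x : RatFunc k} (hx : x ∈ cuspModel k) :
    ∃ p : k[X], p.coeff 1 = 0 ∧ algebraMap k[X] (RatFunc k) p = x := by
  induction hx using Algebra.adjoin_induction with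
  | mem x hx =>
    rcases hx with rfl | rfl
    · exact ⟨X ^ 2, by simp [Polynomial.coeff_X_pow], by simp⟩
    · exact ⟨X ^ 3, by simp [Polynomial.coeff_X_pow], by simp⟩
  | algebraMap c =>
    exact ⟨C c, by simp, by rw [Polynomial.C_eq_algebraMap, ← IsScalarTower.algebraMap_apply]⟩
  | add x y _ _ hx hy =>
    obtain ⟨p, hp, rfl⟩ := hx
    obtain ⟨q, hq, rfl⟩ := hy
    exact ⟨p + q, by simp [hp, hq], by simp⟩
  | mul x y _ _ hx hy =>
    obtain ⟨p, hp, rfl⟩ := hx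
    obtain ⟨q, hq, rfl⟩ := hy
    refine ⟨p * q, ?_, by simp⟩
    simp [Polynomial.coeff_mul, Finset.Nat.sum_antidiagonal_eq_sum_range_succ_mk,
      Finset.sum_range_succ, hp, hq]

/-- KEY COMPUTATION: `t · s = a` with `a, s ∈ k[t², t³]` forces `s(0) = 0`. [folklore] -/
theorem coeff_zero_eq_zero_of_X_mul {a s : RatFunc k} (ha : a ∈ cuspModel k)
    (hs : s ∈ cuspModel k) (hts : RatFunc.X * s = a) {ps : k[X]}
    (hps : algebraMap k[X] (RatFunc k) ps = s) : ps.coeff 0 = 0 := by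
  obtain ⟨pa, hpa1, rfl⟩ := exists_coeff_one_eq_zero_of_mem_cuspModel k ha
  obtain ⟨ps', -, rfl⟩ := exists_coeff_one_eq_zero_of_mem_cuspModel k hs
  have hinj := FaithfulSMul.algebraMap_injective k[X] (RatFunc k)
  obtain rfl : ps = ps' := hinj hps
  have hX : X * ps = pa := hinj (by rw [map_mul, RatFunc.algebraMap_X]; exact hts)
  have := congrArg (fun p : k[X] => p.coeff 1) hX
  simp only [Polynomial.coeff_X_mul] at this
  rw [this, hpa1]

/-- The place of `k(t)` at `t = 0`. [folklore] -/
abbrev cuspPlace : ValuationSubring (RatFunc k) := place (Polynomial.idealX k)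

/-- `k[t², t³] ⊆ k[t]_{(t)}`. [folklore] -/
theorem cuspModel_le_cuspPlace : (cuspModel k).toSubring ≤ (cuspPlace k).toSubring :=
  fun _ hx => polyModel_le_place _ (cuspModel_le_polyModel k hx)

/-- An element of `k[t]` is a non-unit of the place `t = 0` iff its constant term vanishes. [folklore] -/
theorem algebraMap_mem_nonunits_cuspPlace_iff (p : k[X]) :
    algebraMap k[X] (RatFunc k) p ∈ (cuspPlace k).nonunits ↔ p.coeff 0 = 0 := by
  rw [← Polynomial.X_dvd_iff, ← Ideal.mem_span_singleton, ← Polynomial.idealX_span,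
    ← IsLocalization.AtPrime.to_map_mem_maximal_iff (cuspPlace k) (Polynomial.idealX k).asIdeal p,
    ← ValuationSubring.coe_mem_nonunits_iff]
  rfl

/-- `t ≠ a / s` for `a, s ∈ k[t², t³]` with `s(0) ≠ 0` (i.e. `s` a unit at the cusp):
`t ∉ R_𝔮`, in the multiplicative form `t · s ≠ a`. [folklore] -/
theorem X_mul_ne_of_not_mem_nonunits {a s : RatFunc k} (ha : a ∈ cuspModel k)
    (hs : s ∈ cuspModel k) (hsu : s ∉ (cuspPlace k).nonunits) : RatFunc.X * s ≠ a := by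
  intro hts
  obtain ⟨ps, -, hps⟩ := exists_coeff_one_eq_zero_of_mem_cuspModel k hs
  apply hsu
  rw [← hps, algebraMap_mem_nonunits_cuspPlace_iff]
  exact coeff_zero_eq_zero_of_X_mul k ha hs hts hps

/-- **The local ring of the cusp is not regular** (crux conjunct (4) holds for
`W = k[t]_{(t)} ⊇ R = k[t², t³]`): `t² ∈ R` but `t ∉ R_𝔮`. [folklore] -/
theorem not_isRegularLocalRing_cusp (h : (cuspModel k).toSubring ≤ (cuspPlace k).toSubring) :
    ¬ IsRegularLocalRing (Localization.AtPrime
      (Ideal.comap (Subring.inclusion h) (IsLocalRing.maximalIdeal (cuspPlace k)))) := by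
  refine not_isRegularLocalRing_localization_of_pow_mem (R₀ := cuspModel k)
    (Ideal.comap (Subring.inclusion h) (IsLocalRing.maximalIdeal (cuspPlace k)))
    (RatFunc.X : RatFunc k) two_pos ⟨⟨RatFunc.X ^ 2, Algebra.subset_adjoin (by simp)⟩, rfl⟩ ?_
  intro a s hs
  refine X_mul_ne_of_not_mem_nonunits k a.2 s.2 fun hsu => hs ?_
  rw [Ideal.mem_comap, ← ValuationSubring.coe_mem_nonunits_iff]
  exact hsu

/-- **(b) The exceptional set of the crux is NON-EMPTY at the cusp**: `W = k[t]_{(t)}` satisfies all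
five conjuncts for `R = k[t², t³] ⊆ k(t)`.  So `Set.Finite` cannot be improved to `= ∅`, and the
typed conjuncts (1)–(5) are jointly satisfiable (non-vacuity of the crux's predicate). [folklore] -/
theorem cuspPlace_mem_exceptionalSet :
    cuspPlace k ∈ {W : ValuationSubring (RatFunc k) | (∀ c : k, algebraMap k (RatFunc k) c ∈ W) ∧
      IsDiscreteValuationRing W ∧
      (∃ B : Subalgebra k (RatFunc k), B.FG ∧ B.toSubring ≤ W.toSubring ∧ ∀ x : RatFunc k,
        x ∈ W → ∃ b s : RatFunc k, b ∈ B ∧ s ∈ B ∧ s ∉ W.nonunits ∧ x * s = b) ∧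
      (∃ h : (cuspModel k).toSubring ≤ W.toSubring, ¬ IsRegularLocalRing (Localization.AtPrime
        (Ideal.comap (Subring.inclusion h) (IsLocalRing.maximalIdeal W)))) ∧
      ¬ (∃ A : Subalgebra k (RatFunc k), A.FG ∧ IsFractionRing A (RatFunc k) ∧
        ∃ h : A.toSubring ≤ W.toSubring,
        IsRegularLocalRing (Localization.AtPrime
          (Ideal.comap (Subring.inclusion h) (IsLocalRing.maximalIdeal W))) ∧
        (2 : WithBot ℕ∞) ≤ ringKrullDim (Localization.AtPrime
          (Ideal.comap (Subring.inclusion h) (IsLocalRing.maximalIdeal W))))} :=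
  ⟨algebraMap_base_mem_place _, inferInstance, place_essFiniteType _,
    ⟨cuspModel_le_cuspPlace k, not_isRegularLocalRing_cusp k _⟩, not_exists_goodModel _⟩

/-- **NATURAL STRENGTHENING REFUTED: "the exceptional set is empty" is false** (the crux with
`Set.Finite` replaced by `= ∅`, everything else verbatim), at `R = k[t², t³] ⊆ k(t)`, `k = 𝔽₂^alg`
(any field works). [folklore] -/
theorem not_nonRuledCofinite_empty :
    ¬ ∀ (k K : Type) [Field k] [Field K] [Algebra k K] (R : Subalgebra k K), R.FG →
      IsFractionRing R K →
      Literature.AlgebraicGeometry.Resolution.Scheme.HasResolution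
        (AlgebraicGeometry.Spec (CommRingCat.of R)) →
      {W : ValuationSubring K | (∀ c : k, algebraMap k K c ∈ W) ∧ IsDiscreteValuationRing W ∧
        (∃ B : Subalgebra k K, B.FG ∧ B.toSubring ≤ W.toSubring ∧ ∀ x : K, x ∈ W →
          ∃ b s : K, b ∈ B ∧ s ∈ B ∧ s ∉ W.nonunits ∧ x * s = b) ∧
        (∃ h : R.toSubring ≤ W.toSubring, ¬ IsRegularLocalRing (Localization.AtPrime
          (Ideal.comap (Subring.inclusion h) (IsLocalRing.maximalIdeal W)))) ∧
        ¬ (∃ A : Subalgebra k K, A.FG ∧ IsFractionRing A K ∧ ∃ h : A.toSubring ≤ W.toSubring,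
          IsRegularLocalRing (Localization.AtPrime
            (Ideal.comap (Subring.inclusion h) (IsLocalRing.maximalIdeal W))) ∧
          (2 : WithBot ℕ∞) ≤ ringKrullDim (Localization.AtPrime
            (Ideal.comap (Subring.inclusion h) (IsLocalRing.maximalIdeal W))))} = ∅ := by
  intro h
  have he := h (AlgebraicClosure (ZMod 2)) (RatFunc (AlgebraicClosure (ZMod 2))) (cuspModel _)
    (cuspModel_fg _) inferInstance (hasResolution_spec _ _ (cuspModel_fg _))
  exact (Set.eq_empty_iff_forall_notMem.mp he) _ (cuspPlace_mem_exceptionalSet _)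

/-! ## Line `regular-atlas`: stub 2 needs `IsRegularRing B`

`stub_exceptionalCentre` (Lines/regular_atlas.lean) with the hypothesis `IsRegularRing B` deleted
is FALSE at the cusp `R = B = k[t², t³]`, `W = k[t]_{(t)}`: the `Sing` clause and the no-good-model
clause hold, but `W ≠ B_𝔭` elementwise (`t ∈ W`, `t ≠ a/s` with `s(0) ≠ 0`).  (Information for the
lead: regularity of the chart is exactly what makes `W = B_𝔭`; the stub as registered keeps it.) -/

/-- `stub_exceptionalCentre` WITHOUT `IsRegularRing B` is false. [folklore] -/
theorem stub_exceptionalCentre_false_without_isRegularRing :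
    ¬ ∀ (k K : Type) [Field k] [Field K] [Algebra k K] (R B : Subalgebra k K), R ≤ B → B.FG →
      IsFractionRing B K →
      ∀ (W : ValuationSubring K) (hBW : B.toSubring ≤ W.toSubring),
        (∃ h : R.toSubring ≤ W.toSubring, ¬ IsRegularLocalRing (Localization.AtPrime
          (Ideal.comap (Subring.inclusion h) (IsLocalRing.maximalIdeal W)))) →
        (¬ ∃ A : Subalgebra k K, A.FG ∧ IsFractionRing A K ∧ ∃ h : A.toSubring ≤ W.toSubring,
          IsRegularLocalRing (Localization.AtPrime
            (Ideal.comap (Subring.inclusion h) (IsLocalRing.maximalIdeal W))) ∧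
          (2 : WithBot ℕ∞) ≤ ringKrullDim (Localization.AtPrime
            (Ideal.comap (Subring.inclusion h) (IsLocalRing.maximalIdeal W)))) →
        (centreIdeal B W hBW).height = 1 ∧
          ∀ z : K, z ∈ W ↔ ∃ a s : B, s ∉ centreIdeal B W hBW ∧ z = a / s := by
  intro h
  obtain ⟨-, hmem⟩ := h (AlgebraicClosure (ZMod 2)) (RatFunc (AlgebraicClosure (ZMod 2)))
    (cuspModel _) (cuspModel _) le_rfl (cuspModel_fg _) inferInstance (cuspPlace _)
    (cuspModel_le_cuspPlace _) ⟨cuspModel_le_cuspPlace _, not_isRegularLocalRing_cusp _ _⟩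
    (not_exists_goodModel _)
  obtain ⟨a, s, hs, hts⟩ := (hmem RatFunc.X).mp (algebraMap_mem_place _ X)
  have hsu : (s : RatFunc (AlgebraicClosure (ZMod 2))) ∉ (cuspPlace _).nonunits :=
    fun hsu => hs ((mem_centreIdeal_iff_coe_mem_nonunits _ _ _ s).mpr hsu)
  have hs0 : (s : RatFunc (AlgebraicClosure (ZMod 2))) ≠ 0 := by
    rintro h0
    exact hsu (h0 ▸ (cuspPlace _).nonunits.zero_mem')
  exact X_mul_ne_of_not_mem_nonunits _ a.2 s.2 hsu (by rw [hts, div_mul_cancel₀ _ hs0])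

end Summit.ResolutionOfSingularities.ResolutionOfSingularities.Theorems.NonRuledCofinite.Negative

end
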